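import Literature.NumberTheory.LFunctions.WeilCellsZ
import Literature.NumberTheory.LFunctions.WeilSharpConstants
import Literature.NumberTheory.LFunctions.WeilTwoPrimeQuadratic
import HarnessLib

/-!
# Data-driven cells for the two-prime Weil weight

Topic: `Literature/NumberTheory/LFunctions`. The cells of a certified piecewise-polynomial minorant
of the TWO-prime Weil weight
`w₂₃(t) = Re ψ(1/4 + it/2) − √2 log 2 · cos(t log 2) − (2 log 3/√3) · cos(t log 3)`
(`Literature.NumberTheory.LFunctions.weilTwoPrimeWeight`, `WeilTwoPrimeQuadratic.lean`), by verbatim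
adaptation of the first-prime data cells `FPDCell` (`WeilFirstPrimeDataCells.lean`) and of their
integer checker `FPDCell.checkZ` (`WeilCellsZ.lean`):

* the engine constants of the prime-`3` ripple: `√3`, the amplitude `c₃ = 2 log 3/√3` (`cThreeFI`),
  `log 3` (`logThreeLoQ'`, `logThreeHiQ'`), and rational lower bounds `alpha3LoQ u ≤ α₃(u)`,
  `beta3LoQ u ≤ β₃(u)` of `α₃(u) = −c₃ cos(u log 3)`, `β₃(u) = c₃ sin(u log 3)` (fixed-point engine
  `FI` of `Literature/Analysis/ValidatedNumerics`);
* `TPDCell` = a first-prime data cell `fp : FPDCell` (digamma cell + prime-`2` ripple) plus the order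
  `n3` and CLAIMED constants `L3lo ≤ log 3 ≤ L3hi`, `a3lo ≤ α₃(u)`, `b3lo ≤ β₃(u)` of a second ripple
  polynomial (`TPDCell.cosPart3`), checked against the engine by `TPDCell.checkZ`;
* soundness `TPDCell.sigma_le_Z` (`σ ≤ w₂₃` on the cell), the signed bound
  `TPDCell.abs_level_sub_sigma_le_Z` (`|wL − σ| ≤ bndQ`), exact moments `TPDCell.momentQ`
  (`TPDCell.integral_level_sub_sigma_mul_pow`), and the check-free validity predicate
  `TPDCell.Valid` (`TPDCell.valid_of_checkZ`) consumed by the chain layer.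

Everything here is proved; no named facts.

## References

* H. Yoshida, *On Hermitian forms attached to zeta functions*, Adv. Stud. Pure Math. 21 (1992), §6.
  [Yoshida1992]
* R. E. Moore, *Interval Analysis* (1966), Ch. 3. [Moore1966]
-/

noncomputable section

open Complex Finset MeasureTheory Set Filter
open scoped Real Topology BigOperators

namespace Literature.NumberTheory.LFunctions

open Literature.Analysis.ValidatedNumerics.Numerics
open Literature.Analysis.SpecialFunctions

/-! ## Engine constants: `√3`, `2 log 3/√3`, `cos(u log 3)`, `sin(u log 3)` -/

/-- A rational below `√3`. [folklore] -/
def sqrtThreeLoQ : ℚ := 17320508075688772935 / 10000000000000000000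

/-- A rational above `√3`. [folklore] -/
def sqrtThreeHiQ : ℚ := 17320508075688772936 / 10000000000000000000

/-- `sqrtThreeLoQ ≤ √3 ≤ sqrtThreeHiQ`. [folklore] -/
theorem sqrtThree_mem : (sqrtThreeLoQ : ℝ) ≤ Real.sqrt 3 ∧ Real.sqrt 3 ≤ (sqrtThreeHiQ : ℝ) := by
  constructor
  · rw [Real.le_sqrt (by unfold sqrtThreeLoQ; positivity) (by norm_num)]
    unfold sqrtThreeLoQ; norm_num
  · rw [Real.sqrt_le_left (by unfold sqrtThreeHiQ; positivity)]
    unfold sqrtThreeHiQ; norm_num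

/-- `2/√3` as a fixed-point interval (`2/sqrtThreeHiQ ≤ 2/√3 ≤ 2/sqrtThreeLoQ`). [folklore] -/
def twoDivSqrtThreeFI : FI := FI.ofRatRat (2 / sqrtThreeHiQ) (2 / sqrtThreeLoQ)

/-- `2/√3 ∈ twoDivSqrtThreeFI`. [folklore] -/
theorem mem_twoDivSqrtThreeFI : FI.mem (2 / Real.sqrt 3) twoDivSqrtThreeFI := by
  have h := sqrtThree_mem
  have h3 : (0 : ℝ) < Real.sqrt 3 := Real.sqrt_pos.2 (by norm_num)
  have hlo : (0 : ℝ) < sqrtThreeLoQ := by unfold sqrtThreeLoQ; norm_num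
  refine FI.mem_ofRatRat ?_ ?_
  · push_cast
    exact div_le_div_of_nonneg_left (by norm_num) h3 h.2
  · push_cast
    exact div_le_div_of_nonneg_left (by norm_num) (by exact_mod_cast hlo) h.1

/-- `c₃ = 2 log 3/√3` (the amplitude of the prime-3 ripple) as a fixed-point interval. [folklore] -/
def cThreeFI : FI := FI.mul twoDivSqrtThreeFI logThreeFI

/-- `2 log 3/√3 ∈ cThreeFI`. [folklore] -/
theorem mem_cThreeFI : FI.mem (2 * Real.log 3 / Real.sqrt 3) cThreeFI := by
  have h := FI.mem_mul mem_twoDivSqrtThreeFI mem_logThreeFI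
  have e : 2 / Real.sqrt 3 * Real.log 3 = 2 * Real.log 3 / Real.sqrt 3 := by ring
  rw [e] at h
  exact h

/-- Rational lower end of the `log 3` interval. [folklore] -/
def logThreeLoQ' : ℚ := logThreeFI.loQ

/-- Rational upper end of the `log 3` interval. [folklore] -/
def logThreeHiQ' : ℚ := logThreeFI.hiQ

/-- `logThreeLoQ' ≤ log 3 ≤ logThreeHiQ'`. [folklore] -/
theorem logThree_mem_Q : (logThreeLoQ' : ℝ) ≤ Real.log 3 ∧ Real.log 3 ≤ (logThreeHiQ' : ℝ) :=
  ⟨FI.loQ_le mem_logThreeFI, FI.le_hiQ mem_logThreeFI⟩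

/-- `u log 3` as an interval, for a rational `u`. [folklore] -/
def theta3FI (u : ℚ) : FI := FI.mul (FI.ofRat u) logThreeFI

/-- `u log 3 ∈ theta3FI u`. [folklore] -/
theorem mem_theta3FI (u : ℚ) : FI.mem ((u : ℝ) * Real.log 3) (theta3FI u) :=
  FI.mem_mul (FI.mem_ofRat u) mem_logThreeFI

/-- A rational `≤ α₃(u) := −(2 log 3/√3) · cos(u log 3)`. [folklore] -/
def alpha3LoQ (u : ℚ) : ℚ := (FI.neg (FI.mul cThreeFI (FI.cosSin (theta3FI u)).1)).loQ

/-- A rational `≤ β₃(u) := (2 log 3/√3) · sin(u log 3)`. [folklore] -/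
def beta3LoQ (u : ℚ) : ℚ := (FI.mul cThreeFI (FI.cosSin (theta3FI u)).2).loQ

/-- `alpha3LoQ u ≤ −(2 log 3/√3) cos(u log 3)`. [folklore] -/
theorem alpha3LoQ_le (u : ℚ) :
    (alpha3LoQ u : ℝ) ≤ -(2 * Real.log 3 / Real.sqrt 3 * Real.cos ((u : ℝ) * Real.log 3)) := by
  have h := (FI.mem_cosSin (mem_theta3FI u)).1
  have hm := FI.mem_neg (FI.mem_mul mem_cThreeFI h)
  exact FI.loQ_le hm

/-- `beta3LoQ u ≤ (2 log 3/√3) sin(u log 3)`. [folklore] -/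
theorem beta3LoQ_le (u : ℚ) :
    (beta3LoQ u : ℝ) ≤ 2 * Real.log 3 / Real.sqrt 3 * Real.sin ((u : ℝ) * Real.log 3) := by
  have h := (FI.mem_cosSin (mem_theta3FI u)).2
  exact FI.loQ_le (FI.mem_mul mem_cThreeFI h)

/-! ## Two-prime cells with claimed (data) constants -/

/-- A DATA-DRIVEN cell of a certified minorant of `w₂₃`: a first-prime data cell `fp` (digamma cell
`fp.psi` on `[u, v]` plus the prime-`2` ripple polynomial), the truncation order `n3 ≥ 1` of the
trigonometric brackets of the prime-`3` ripple, and CLAIMED rationals `L3lo ≤ log 3 ≤ L3hi`,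
`a3lo ≤ α₃(u) = −(2 log 3/√3) cos(u log 3)`, `b3lo ≤ β₃(u) = (2 log 3/√3) sin(u log 3)`, which the
checker verifies against the engine (`logThreeLoQ'/HiQ'`, `alpha3LoQ`, `beta3LoQ`); the second ripple
polynomial (`TPDCell.cosPart3`) is then an exact function of the data. [folklore] -/
structure TPDCell where
  /-- the first-prime data cell (digamma cell + prime-`2` ripple) on `[u, v]` -/
  fp : FPDCell
  /-- order of the Maclaurin brackets of `cos(hL₃)`, `sin(hL₃)`, `h = t − u`, `L₃ = log 3` -/
  n3 : ℕ
  /-- claimed rational lower end for `log 3` (checked: `L3lo ≤ logThreeLoQ'`, `0 ≤ L3lo`) -/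
  L3lo : ℚ
  /-- claimed rational upper end for `log 3` (checked: `logThreeHiQ' ≤ L3hi`) -/
  L3hi : ℚ
  /-- claimed lower bound of `α₃(u) = −(2 log 3/√3) cos(u log 3)` (checked: `a3lo ≤ alpha3LoQ u`) -/
  a3lo : ℚ
  /-- claimed lower bound of `β₃(u) = (2 log 3/√3) sin(u log 3)` (checked: `b3lo ≤ beta3LoQ u`) -/
  b3lo : ℚ

namespace TPDCell

variable (c : TPDCell)

/-- The bracket of `cos(hL₃)` used with the sign of `a3lo`: lower if `a3lo ≥ 0`, upper otherwise. [folklore] -/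
def cosBracket3 : List ℚ :=
  if 0 ≤ c.a3lo then cosLoCoeffs c.L3lo c.L3hi c.n3 else cosUpCoeffs c.L3lo c.L3hi c.n3

/-- The bracket of `sin(hL₃)` used with the sign of `b3lo`. [folklore] -/
def sinBracket3 : List ℚ :=
  if 0 ≤ c.b3lo then sinLoCoeffs c.L3lo c.L3hi c.n3 else sinUpCoeffs c.L3lo c.L3hi c.n3

/-- The prime-`3` ripple polynomial of the cell: coefficients of `h^k`, `h = t − u`, of
`a3lo · (cos bracket) + b3lo · (sin bracket)`, a lower bound of `−(2 log 3/√3) cos(t log 3)`. [folklore] -/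
def cosPart3 : List ℚ :=
  tabV (c.n3 + 1) fun k ↦ c.a3lo * getV c.cosBracket3 k + c.b3lo * getV c.sinBracket3 k

/-- The cell polynomial `σ(t) = σ_fp(t) + P₃(t − u)` (first-prime cell polynomial plus the second
ripple polynomial). [folklore] -/
def sigma (t : ℝ) : ℝ := c.fp.sigma t + polyR c.cosPart3 (t - c.fp.psi.u)

/-- `Σ_k |p_k| (v − u)^k`, an upper bound of `|P₃|` on the cell. [folklore] -/
def absPart3Q : ℚ := sumR (c.n3 + 1) fun k ↦ |getV c.cosPart3 k| * (c.fp.psi.v - c.fp.psi.u) ^ k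

/-- All checks of a two-prime cell, integer form: the first-prime part by `FPDCell.checkZ`, then
`n3 ≥ 1`, `0 ≤ L3lo`, `(v − u) · L3hi ≤ 1` (so `0 ≤ hL₃ ≤ 1` on the cell), and the claimed constants
against the engine. (No level test: the certificate works with a SIGNED `γ = wL − σ`.) [folklore] -/
def checkZ (p j : ℕ) : Bool :=
  c.fp.checkZ p j && decide (0 < c.n3) && decide (0 ≤ c.L3lo) &&
    decide ((c.fp.psi.v - c.fp.psi.u) * c.L3hi ≤ 1) &&
    decide (c.L3lo ≤ logThreeLoQ') && decide (logThreeHiQ' ≤ c.L3hi) &&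
    decide (c.a3lo ≤ alpha3LoQ c.fp.psi.u) && decide (c.b3lo ≤ beta3LoQ c.fp.psi.u)

variable {c} {p j : ℕ}

/-- Unpacking `checkZ`. [folklore] -/
theorem checkZ_spec (h : c.checkZ p j = true) :
    c.fp.checkZ p j = true ∧ 0 < c.n3 ∧ 0 ≤ c.L3lo ∧
      (c.fp.psi.v - c.fp.psi.u) * c.L3hi ≤ 1 ∧
      c.L3lo ≤ logThreeLoQ' ∧ logThreeHiQ' ≤ c.L3hi ∧
      c.a3lo ≤ alpha3LoQ c.fp.psi.u ∧ c.b3lo ≤ beta3LoQ c.fp.psi.u := by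
  simp only [checkZ, Bool.and_eq_true, decide_eq_true_eq] at h
  exact ⟨h.1.1.1.1.1.1.1, h.1.1.1.1.1.1.2, h.1.1.1.1.1.2, h.1.1.1.1.2, h.1.1.1.2, h.1.1.2, h.1.2, h.2⟩

/-- A `Z`-checked cell has `0 ≤ u`. [folklore] -/
theorem u_nonneg_Z (h : c.checkZ p j = true) : 0 ≤ c.fp.psi.u :=
  FPDCell.u_nonneg_Z (checkZ_spec h).1

/-- A `Z`-checked cell has `u < v`. [folklore] -/
theorem u_lt_v_Z (h : c.checkZ p j = true) : c.fp.psi.u < c.fp.psi.v :=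
  FPDCell.u_lt_v_Z (checkZ_spec h).1

/-- Lengths of the brackets. [folklore] -/
theorem length_cosBracket3 (c : TPDCell) : c.cosBracket3.length = c.n3 + 1 := by
  unfold cosBracket3 cosLoCoeffs cosUpCoeffs; split_ifs <;> simp [tabV]

/-- Lengths of the brackets. [folklore] -/
theorem length_sinBracket3 (c : TPDCell) : c.sinBracket3.length = c.n3 + 1 := by
  unfold sinBracket3 sinLoCoeffs sinUpCoeffs; split_ifs <;> simp [tabV]

/-- `P₃(h) = a3lo · (cos bracket)(h) + b3lo · (sin bracket)(h)`. [folklore] -/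
theorem polyR_cosPart3 (c : TPDCell) (h : ℝ) :
    polyR c.cosPart3 h =
      (c.a3lo : ℝ) * polyR c.cosBracket3 h + (c.b3lo : ℝ) * polyR c.sinBracket3 h := by
  unfold cosPart3
  rw [polyR_tabV]
  unfold polyR
  rw [length_cosBracket3, length_sinBracket3, Finset.mul_sum, Finset.mul_sum, ← Finset.sum_add_distrib]
  refine Finset.sum_congr rfl fun k _ ↦ ?_
  push_cast
  ring

/-- **Second-ripple soundness from the unpacked side conditions.** On the cell,
`P₃(t − u) ≤ −(2 log 3/√3) cos(t log 3)` (addition formula at `u`, signed Maclaurin brackets of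
`cos(hL₃)`, `sin(hL₃)` on `0 ≤ hL₃ ≤ 1`). [folklore] -/
theorem polyR_cosPart3_le_of (hn : 0 < c.n3) (hL0q : 0 ≤ c.L3lo)
    (hwq : (c.fp.psi.v - c.fp.psi.u) * c.L3hi ≤ 1) (hLloq : c.L3lo ≤ logThreeLoQ')
    (hLhiq : logThreeHiQ' ≤ c.L3hi)
    (haloq : c.a3lo ≤ alpha3LoQ c.fp.psi.u) (hbloq : c.b3lo ≤ beta3LoQ c.fp.psi.u)
    {t : ℝ} (hut : (c.fp.psi.u : ℝ) ≤ t) (htv : t ≤ (c.fp.psi.v : ℝ)) :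
    polyR c.cosPart3 (t - c.fp.psi.u) ≤
      -(2 * Real.log 3 / Real.sqrt 3 * Real.cos (t * Real.log 3)) := by
  set L : ℝ := Real.log 3 with hLdef
  set u : ℝ := (c.fp.psi.u : ℝ) with hudef
  set hh : ℝ := t - u with hhdef
  have hL0 : (0 : ℝ) ≤ c.L3lo := by exact_mod_cast hL0q
  have hL1 : (c.L3lo : ℝ) ≤ L := le_trans (by exact_mod_cast hLloq) logThree_mem_Q.1
  have hL2 : L ≤ (c.L3hi : ℝ) := le_trans logThree_mem_Q.2 (by exact_mod_cast hLhiq)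
  have hLnn : 0 ≤ L := hL0.trans hL1
  have hh0 : 0 ≤ hh := by rw [hhdef]; linarith
  have hhw : hh ≤ (c.fp.psi.v : ℝ) - c.fp.psi.u := by rw [hhdef, hudef]; linarith
  have hhL : hh * L ≤ 1 := by
    have h1 : hh * L ≤ ((c.fp.psi.v : ℝ) - c.fp.psi.u) * c.L3hi :=
      mul_le_mul hhw hL2 hLnn (by linarith)
    have h2 : ((c.fp.psi.v : ℝ) - c.fp.psi.u) * c.L3hi ≤ 1 := by exact_mod_cast hwq
    linarith
  have hy0 : 0 ≤ hh * L := mul_nonneg hh0 hLnn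
  have hcos0 : 0 ≤ Real.cos (hh * L) :=
    Real.cos_nonneg_of_mem_Icc ⟨by linarith [Real.pi_pos], by linarith [Real.pi_gt_three]⟩
  have hsin0 : 0 ≤ Real.sin (hh * L) :=
    Real.sin_nonneg_of_nonneg_of_le_pi hy0 (by linarith [Real.pi_gt_three])
  -- addition formula at the left end point
  set α : ℝ := -(2 * Real.log 3 / Real.sqrt 3 * Real.cos (u * L)) with hαdef
  set β : ℝ := 2 * Real.log 3 / Real.sqrt 3 * Real.sin (u * L) with hβdef
  have hadd : -(2 * Real.log 3 / Real.sqrt 3 * Real.cos (t * Real.log 3)) =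
      α * Real.cos (hh * L) + β * Real.sin (hh * L) := by
    have : t * Real.log 3 = u * L + hh * L := by rw [hhdef, hLdef]; ring
    rw [this, Real.cos_add, hαdef, hβdef]
    ring
  have ha : (c.a3lo : ℝ) ≤ α := by
    rw [hαdef, hudef, hLdef]; exact le_trans (by exact_mod_cast haloq) (alpha3LoQ_le c.fp.psi.u)
  have hb : (c.b3lo : ℝ) ≤ β := by
    rw [hβdef, hudef, hLdef]; exact le_trans (by exact_mod_cast hbloq) (beta3LoQ_le c.fp.psi.u)
  rw [hadd, polyR_cosPart3]
  refine add_le_add ?_ ?_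
  · unfold cosBracket3
    split_ifs with hsgn
    · have h0 : (0 : ℝ) ≤ c.a3lo := by exact_mod_cast hsgn
      calc (c.a3lo : ℝ) * polyR (cosLoCoeffs c.L3lo c.L3hi c.n3) hh
          ≤ (c.a3lo : ℝ) * Real.cos (hh * L) :=
            mul_le_mul_of_nonneg_left (polyR_cosLo_le hL0 hL1 hL2 hh0 hhL hn) h0
        _ ≤ α * Real.cos (hh * L) := mul_le_mul_of_nonneg_right ha hcos0
    · push Not at hsgn
      have h0 : (c.a3lo : ℝ) ≤ 0 := by exact_mod_cast hsgn.le
      calc (c.a3lo : ℝ) * polyR (cosUpCoeffs c.L3lo c.L3hi c.n3) hh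
          ≤ (c.a3lo : ℝ) * Real.cos (hh * L) :=
            mul_le_mul_of_nonpos_left (cos_le_polyR_cosUp hL0 hL1 hL2 hh0 hhL hn) h0
        _ ≤ α * Real.cos (hh * L) := mul_le_mul_of_nonneg_right ha hcos0
  · unfold sinBracket3
    split_ifs with hsgn
    · have h0 : (0 : ℝ) ≤ c.b3lo := by exact_mod_cast hsgn
      calc (c.b3lo : ℝ) * polyR (sinLoCoeffs c.L3lo c.L3hi c.n3) hh
          ≤ (c.b3lo : ℝ) * Real.sin (hh * L) :=
            mul_le_mul_of_nonneg_left (polyR_sinLo_le hL0 hL1 hL2 hh0 hhL hn) h0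
        _ ≤ β * Real.sin (hh * L) := mul_le_mul_of_nonneg_right hb hsin0
    · push Not at hsgn
      have h0 : (c.b3lo : ℝ) ≤ 0 := by exact_mod_cast hsgn.le
      calc (c.b3lo : ℝ) * polyR (sinUpCoeffs c.L3lo c.L3hi c.n3) hh
          ≤ (c.b3lo : ℝ) * Real.sin (hh * L) :=
            mul_le_mul_of_nonpos_left (sin_le_polyR_sinUp hL0 hL1 hL2 hh0 hhL hn) h0
        _ ≤ β * Real.sin (hh * L) := mul_le_mul_of_nonneg_right hb hsin0

/-- **Cell soundness (integer checker).** On its cell,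
`σ(t) ≤ w₂₃(t) = Re ψ(1/4 + it/2) − √2 log 2 cos(t log 2) − (2 log 3/√3) cos(t log 3)`. [folklore] -/
theorem sigma_le_Z (h : c.checkZ p j = true) {t : ℝ} (hut : (c.fp.psi.u : ℝ) ≤ t)
    (htv : t ≤ (c.fp.psi.v : ℝ)) : c.sigma t ≤ weilTwoPrimeWeight t := by
  obtain ⟨hfp, hn, hL0q, hwq, hLloq, hLhiq, haloq, hbloq⟩ := checkZ_spec h
  have h1 := FPDCell.sigma_le_Z hfp hut htv
  have h2 := polyR_cosPart3_le_of hn hL0q hwq hLloq hLhiq haloq hbloq hut htv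
  unfold sigma weilTwoPrimeWeight
  linarith

/-- Cast of `absPart3Q`. [folklore] -/
theorem absPart3Q_cast (c : TPDCell) :
    ((c.absPart3Q : ℚ) : ℝ) = ∑ k ∈ Finset.range (c.n3 + 1),
      |((getV c.cosPart3 k : ℚ) : ℝ)| * ((c.fp.psi.v : ℝ) - c.fp.psi.u) ^ k := by
  unfold absPart3Q; rw [sumR_eq_sum]; push_cast; rfl

/-- A bound for `|wL − σ|` on the cell: the first-prime bound `fp.bndQ wL` plus `Σ_k |p_k|(v−u)^k`
for the second ripple polynomial. [folklore] -/
def bndQ (wL : ℚ) : ℚ := c.fp.bndQ wL + c.absPart3Q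

/-- **Signed-`γ` control** (from `0 ≤ u` only). On the cell, `|wL − σ(t)| ≤ bndQ wL`. [folklore] -/
theorem abs_level_sub_sigma_le_of (hu0 : 0 ≤ c.fp.psi.u) (wL : ℚ) {t : ℝ}
    (hut : (c.fp.psi.u : ℝ) ≤ t) (htv : t ≤ (c.fp.psi.v : ℝ)) :
    |(wL : ℝ) - c.sigma t| ≤ c.bndQ wL := by
  have h1 := FPDCell.abs_level_sub_sigma_le_of hu0 wL hut htv
  have hlen : c.cosPart3.length = c.n3 + 1 := by simp [cosPart3, tabV]
  have h2 := abs_polyR_le c.cosPart3 (h := t - c.fp.psi.u) (w := (c.fp.psi.v : ℝ) - c.fp.psi.u)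
    (by linarith) (by linarith)
  rw [hlen, ← absPart3Q_cast] at h2
  unfold sigma bndQ
  push_cast
  have e : (wL : ℝ) - (c.fp.sigma t + polyR c.cosPart3 (t - c.fp.psi.u)) =
      ((wL : ℝ) - c.fp.sigma t) - polyR c.cosPart3 (t - c.fp.psi.u) := by ring
  rw [e]
  exact (abs_sub _ _).trans (add_le_add h1 h2)

/-- `0 ≤ bndQ` (from `0 ≤ u < v` only). [folklore] -/
theorem bndQ_nonneg_of (hu : 0 ≤ c.fp.psi.u) (huv : c.fp.psi.u < c.fp.psi.v) (wL : ℚ) :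
    0 ≤ c.bndQ wL := by
  have h1 := FPDCell.bndQ_nonneg_of hu huv wL
  have h2 : 0 ≤ c.fp.psi.v - c.fp.psi.u := by linarith
  unfold bndQ absPart3Q
  rw [sumR_eq_sum]
  exact add_nonneg h1 (Finset.sum_nonneg fun k _ ↦ mul_nonneg (abs_nonneg _) (pow_nonneg h2 _))

/-- Signed-`γ` control for a `Z`-checked cell: `|wL − σ(t)| ≤ bndQ wL` on the cell. [folklore] -/
theorem abs_level_sub_sigma_le_Z (h : c.checkZ p j = true) (wL : ℚ) {t : ℝ}
    (hut : (c.fp.psi.u : ℝ) ≤ t) (htv : t ≤ (c.fp.psi.v : ℝ)) :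
    |(wL : ℝ) - c.sigma t| ≤ (c.bndQ wL : ℝ) :=
  abs_level_sub_sigma_le_of (u_nonneg_Z h) wL hut htv

/-- `0 ≤ bndQ` for a `Z`-checked two-prime cell. [folklore] -/
theorem bndQ_nonneg_Z (h : c.checkZ p j = true) (wL : ℚ) : 0 ≤ (c.bndQ wL : ℚ) :=
  bndQ_nonneg_of (u_nonneg_Z h) (u_lt_v_Z h) wL

/-- Continuity of the cell polynomial. [folklore] -/
theorem continuous_sigma (c : TPDCell) : Continuous c.sigma := by
  unfold sigma polyR
  exact c.fp.continuous_sigma.add (continuous_finsetSum _ fun k _ ↦ by fun_prop)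

/-! ### Exact moments of a two-prime cell -/

/-- `∫_u^v (wL − σ(s)) s^q ds` in closed form: the first-prime moment minus
`Σ_k p_k ∫_u^v (s − u)^k s^q ds`. [folklore] -/
def momentQ (wL : ℚ) (c : TPDCell) (q : ℕ) : ℚ :=
  c.fp.momentQ wL q - sumR (c.n3 + 1) fun k ↦ getV c.cosPart3 k * c.fp.shiftPowIntQ k q

/-- **Cell moments.** `∫_u^v (wL − σ(s)) s^q ds = momentQ`. [folklore] -/
theorem integral_level_sub_sigma_mul_pow (wL : ℚ) (c : TPDCell) (q : ℕ) :
    ∫ s in (c.fp.psi.u : ℝ)..c.fp.psi.v, ((wL : ℝ) - c.sigma s) * s ^ q = (c.momentQ wL q : ℝ) := by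
  have hlen : c.cosPart3.length = c.n3 + 1 := by simp [cosPart3, tabV]
  have hpt : ∀ s : ℝ, ((wL : ℝ) - c.sigma s) * s ^ q =
      ((wL : ℝ) - c.fp.sigma s) * s ^ q -
        ∑ k ∈ Finset.range (c.n3 + 1),
          ((getV c.cosPart3 k : ℚ) : ℝ) * ((s - c.fp.psi.u) ^ k * s ^ q) := by
    intro s
    unfold sigma polyR
    rw [hlen]
    have : (∑ k ∈ Finset.range (c.n3 + 1),
        ((getV c.cosPart3 k : ℚ) : ℝ) * (s - c.fp.psi.u) ^ k) * s ^ q =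
        ∑ k ∈ Finset.range (c.n3 + 1),
          ((getV c.cosPart3 k : ℚ) : ℝ) * ((s - c.fp.psi.u) ^ k * s ^ q) := by
      rw [Finset.sum_mul]
      exact Finset.sum_congr rfl fun k _ ↦ by ring
    rw [show ((wL : ℝ) - (c.fp.sigma s + ∑ k ∈ Finset.range (c.n3 + 1),
        ((getV c.cosPart3 k : ℚ) : ℝ) * (s - c.fp.psi.u) ^ k)) * s ^ q =
        ((wL : ℝ) - c.fp.sigma s) * s ^ q - (∑ k ∈ Finset.range (c.n3 + 1),
        ((getV c.cosPart3 k : ℚ) : ℝ) * (s - c.fp.psi.u) ^ k) * s ^ q by ring, this]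
  simp_rw [hpt]
  have i0 : IntervalIntegrable (fun s ↦ ((wL : ℝ) - c.fp.sigma s) * s ^ q) volume
      c.fp.psi.u c.fp.psi.v :=
    ((continuous_const.sub c.fp.continuous_sigma).mul (continuous_pow q)).intervalIntegrable _ _
  have iK : ∀ k, IntervalIntegrable
      (fun s : ℝ ↦ ((getV c.cosPart3 k : ℚ) : ℝ) * ((s - c.fp.psi.u) ^ k * s ^ q)) volume
      c.fp.psi.u c.fp.psi.v :=
    fun k ↦ (continuous_const.mul ((continuous_pow k |>.comp (continuous_sub_right _)).mul
      (continuous_pow q))).intervalIntegrable _ _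
  have iS : IntervalIntegrable (fun s : ℝ ↦ ∑ k ∈ Finset.range (c.n3 + 1),
      ((getV c.cosPart3 k : ℚ) : ℝ) * ((s - c.fp.psi.u) ^ k * s ^ q)) volume
      c.fp.psi.u c.fp.psi.v :=
    (continuous_finsetSum _ fun k _ ↦ (continuous_const.mul ((continuous_pow k |>.comp
      (continuous_sub_right _)).mul (continuous_pow q)))).intervalIntegrable _ _
  rw [intervalIntegral.integral_sub i0 iS, FPDCell.integral_level_sub_sigma_mul_pow,
    intervalIntegral.integral_finsetSum fun k _ ↦ iK k]
  unfold momentQ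
  rw [sumR_eq_sum]
  push_cast
  congr 1
  refine Finset.sum_congr rfl fun k _ ↦ ?_
  rw [intervalIntegral.integral_const_mul, FPDCell.integral_shift_pow_mul_pow]

/-! ### Valid cells -/

/-- What the chain lemmas use about a two-prime cell: `0 ≤ u < v`, `σ ≤ w₂₃` on the cell, the
signed bound `|wL − σ| ≤ bndQ wL` on the cell, and `0 ≤ bndQ`. [folklore] -/
structure Valid (c : TPDCell) : Prop where
  /-- `0 ≤ u` -/
  u_nonneg : 0 ≤ c.fp.psi.u
  /-- `u < v` -/
  u_lt_v : c.fp.psi.u < c.fp.psi.v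
  /-- `σ ≤ w₂₃` on the cell -/
  sigma_le : ∀ t : ℝ, (c.fp.psi.u : ℝ) ≤ t → t ≤ c.fp.psi.v → c.sigma t ≤ weilTwoPrimeWeight t
  /-- `|wL − σ| ≤ bndQ wL` on the cell -/
  abs_le : ∀ (wL : ℚ) (t : ℝ), (c.fp.psi.u : ℝ) ≤ t → t ≤ c.fp.psi.v →
    |(wL : ℝ) - c.sigma t| ≤ c.bndQ wL
  /-- `0 ≤ bndQ wL` -/
  bndQ_nonneg : ∀ wL : ℚ, 0 ≤ c.bndQ wL

/-- An integer-checked cell (`TPDCell.checkZ`) is valid. [folklore] -/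
theorem valid_of_checkZ (h : c.checkZ p j = true) : c.Valid :=
  ⟨u_nonneg_Z h, u_lt_v_Z h, fun _t hut htv ↦ sigma_le_Z h hut htv,
    fun wL _t hut htv ↦ abs_level_sub_sigma_le_Z h wL hut htv, fun wL ↦ bndQ_nonneg_Z h wL⟩

end TPDCell

end Literature.NumberTheory.LFunctions
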